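import Summits.QuantumFields.YangMills.Theorems.BalabanUVNodesN15KingModelAnalyticBlockCovWoodbury
import HarnessLib

/-!
# BalabanUVNodes ∕ N15 — THE KING-MODEL RUNG (PART Ϫ-b): THE WINDOW OF THE CONTINUED BLOCK-FIELD COVARIANCE NEEDS NO CURVATURE HYPOTHESIS — at EVERY unitary background `U₀`
# (any curvature) both `A₀(U₀)` and `B(U₀) = −cΔ_{U₀} + m²` are `m²`-coercive (PART Ϥ-k's mass floor), so PART Ϩ-g's `king_B9_thm34_shape` at `κ = m²` certifies `A(U,U⁻¹)` AND
# `B(U,U⁻¹)` on print's slice for `‖U_b − U₀_b‖ ≤ ε`, `Lε ≤ s₀(m²,a,d)` (King's scaling `c = L²`, comb-depth contours): there ★★★★ `Δ_eff(U,U⁻¹)` IS INVERTIBLE WITH INVERSE THE WOODBURY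
# FORM `C(U,U⁻¹)`, and ★★★★ KING's UNIFORM EXPONENTIAL DECAY OF `C^{(k)}` ((4.32)–(4.34)) HOLDS IN THE COMPLEX POLYDISC: `‖blk C(U,U⁻¹) y y′‖ ≤ a⁻¹[y = y′] + (8∕m²)e³·e^{−ctRate(m²∕2,0,d)·d_M(y,y′)}`, `η`-uniformly
# (Track A, DAG node N15 = NE2; FAN-OUT v1.1 §N15 s3 «KING-MODEL RUNG … + what the curved case adds»; count-neutral)

HONEST FRAMING.  Count-neutral (cell `pub-ymgap`, seat `pub-ymgap-dag-n15-e` g52; `--supports stmt-QuantumFields-27247 --as helper` = K3ᴬ, KEY MAP v3).  King's one-level comparison model,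
MASSIVE fine covariance (`m² > 0`; at `m² = 0` the block-field covariance does not exist at flat `U₀`), any fibre `𝕜ⁿ`, King's scaling `c = L²`, contours of depth `≤ (d+1)(L−1)` (the comb).
The window constant is the FINE MASS `m²`, not the block mass `κ₀ ≥ m²` of PART Ϩ-g's classes — honest: `(Δ_eff)⁻¹ ∼ a⁻¹ + m⁻²` is as large as the fine covariance allows.  The decay
at a UNITARY field is also PART Ϥ-l's (Kato domination by King's `A = 0` kernel, King's constants); here a second proof with Combes–Thomas constants, valid OFF the unitary slice.
NOT Bałaban's multi-level `C^{(k)}(U)`; NOT a node discharge (N15 of record untouched); nothing continuum ∕ ℝ⁴ ∕ OS ∕ Clay.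

ERRATUM-Ϫ1 (v1.1, DOC-ONLY; ref-I READ-1090 N1, verified first-hand on the held page p.674 of [King1986]): (4.32) defines `C^{(k)}_Ω(s)`; the sentence after it states that `C^{(k)}_Ω(s)` «has uniform exponential decay» once (4.33) (the lower bound `C ≥ γ₀I`) and (4.34) (decay of `C⁻¹`) hold; (4.35)–(4.37) are the momentum sums proving (4.33); Lemma 4.5 = (4.38) is the two-spacing difference WITH decay; (4.44) p.675 is the resolvent∕Woodbury-type difference identity and (4.45) its Fourier representation.  v1.0 of this file cited «(4.37)» for the decay of `C^{(k)}` and «(4.45)» for the Woodbury form ∕ floors; v1.1 cites (4.32)–(4.34) for the decay, (4.38) for Lipschitz-with-decay shapes, (4.33) for lower bounds ∕ floors and (4.44) for the Woodbury form.  Declarations byte-identical to v1.0.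

THE RESULTS (`L ≥ 1`, volume `M`, fibre `𝕜ⁿ`, comb-depth `T`, `a > 0`, `m² > 0`, unitary `U₀`, complex `U` with `‖U_b − U₀_b‖ ≤ ε`, `Lε ≤ s₀(m²,a,d)`):
* §1 `sliceRadius_anti` (`s₀(κ,a,d) ≤ s₀(κ,0,d)` for `a ≥ 0`), `mass_coercive_fullOpU` (the `m²`-floor in PART Ϩ's currency, every `a, c ≥ 0`).
* §2 `A(U,U⁻¹)` invertible = Ϩ-g `isUnit_cxFullOp_at_radius` at `κ = m²` (cited inline), ★ `isUnit_cxFullOp_zero_at_massRadius` (`B(U,U⁻¹)`), `l2_opNorm_cxFullOp_zero_inv_at_massRadius_le` (`‖B⁻¹‖ ≤ 4∕m²`),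
  `norm_blk_cxFullOp_zero_inv_at_massRadius_le` (`‖blk B⁻¹ x x′‖ ≤ (8∕m²)e^{−ctRate(m²∕2,0,d)d(x,x′)∕L}`), ★★★★ **`isUnit_cxEffLap_at_massRadius`**, ★★★★ **`inv_cxEffLap_at_massRadius`**
  (`(Δ_eff(U,U⁻¹))⁻¹ = C(U,U⁻¹)`), `cxEffLap_mul_cxBlockCov_at_massRadius`, `isUnit_cxBlockCov_at_massRadius`.
* §3 ★★★ `norm_blk_cxBlockCov_zero_sandwich_at_massRadius_le` (`‖blk (C − a⁻¹1) y y′‖ ≤ (8∕m²)e³e^{−ctRate(m²∕2,0,d)d_M(y,y′)}`), ★★★★ **`norm_blk_cxBlockCov_at_massRadius_le`** (KING's `C^{(k)}` DECAY ((4.32)–(4.34)) IN THE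
  COMPLEX POLYDISC: `‖blk C(U,U⁻¹) y y′‖ ≤ a⁻¹[y=y′] + (8∕m²)e³e^{−ctRate(m²∕2,0,d)d_M(y,y′)}`), ★★★ `norm_blk_cxBlockCov_at_massRadius_le'` (`≤ (a⁻¹ + (8∕m²)e³)e^{−ctRate(m²∕2,0,d)d_M(y,y′)}`),
  `norm_blk_cxBlockCov_offDiag_at_massRadius_le`.
* §4 AT A UNITARY FIELD (`ε = 0`, every unitary `U`, no window): ★★★ **`norm_blk_effLapU_inv_le`** (`‖blk (Δ_eff(U))⁻¹ y y′‖ ≤ a⁻¹[y=y′] + (8∕m²)e³e^{−ctRate(m²∕2,0,d)d_M(y,y′)}` — King's `C^{(k)}` decay ((4.32)–(4.34))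
  AT EVERY CURVED BACKGROUND with Combes–Thomas constants), ★★★ **`king_blockCov_window`** (the conjunction).
PRIOR TREE ART (by name): Ϫ-a (`cxBlockCov`, `cxEffLap_mul_cxBlockCov`, `inv_cxEffLap_eq_cxBlockCov`, `isUnit_cxEffLap_of_isUnit`, `isUnit_cxBlockCov_of_isUnit`, `blk_cxBlockCov`, `cxBlockCov_inv_of_unitary`),
Ϩ-g (`sliceRadius`, `king_B9_thm34_shape`, `isUnit_cxFullOp_at_radius`, `l2_opNorm_cxFullOp_inv_at_radius_le`, `norm_blk_cxFullOp_inv_at_radius_le`), Ϩ-l (`norm_blk_cxSandwich_at_radius_le`),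
Ϥ-k (`re_quadForm_fullOpU_ge_mass`), Ϧ-a (`ctRate`, `ctRate_nonneg`).  Dedup (rg at filing): basename 0 files; needles `massRadius|norm_blk_effLapU_inv_le|king_blockCov_window` 0 tree files; preflight `dedup.landed` caught an `A`-invertibility wrapper ≡ Ϩ-g `isUnit_cxFullOp_at_radius` — deleted, cited inline.
Locators: [King1986] (2.14) p.653, (4.32)–(4.34) p.674, (4.44) p.675; [Balaban1985BackgroundPropagators] (3.25) p.394, Thm 3.4 p.400; [Dimock2013] App. D Lemma 30.  0 `sorry`, 0 `def`.
-/

noncomputable section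
open scoped BigOperators ComplexConjugate ComplexOrder Matrix.Norms.L2Operator
open Finset Matrix

namespace Summit.QuantumFields.YangMills.BalabanUVNodes.N15KingModelRung.Analytic

open Literature.MathematicalPhysics.QuantumFieldTheory.LatticeDiamagneticInequality (blk)
open Literature.MathematicalPhysics.QuantumFieldTheory.Balaban1983to89.B5Prop11Plancherel (Tor fine)
open Literature.MathematicalPhysics.QuantumFieldTheory.King1986.Torus (tdistT tdistT_self tdistT_nonneg)
open Summit.QuantumFields.YangMills.BalabanUVNodes.N15KingModelRung.Covariant (fib)
open Summit.QuantumFields.YangMills.BalabanUVNodes.N15KingModelRung.CovariantBlock (BlockTree covQ fullOpU effLapU re_quadForm_fullOpU_ge_mass)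
open Summit.QuantumFields.YangMills.BalabanUVNodes.N15KingModelRung.CombesThomas (ctRate ctRate_nonneg)

/-! ## §1 The radius is antitone in the block coupling; the mass floor -/

section Prelim

/-- `s₀(κ,a,d) ≤ s₀(κ,0,d)` for `a ≥ 0`, `κ ≥ 0`: the zero-coupling operator `B` is certified on (at least) the window of `A`. [cite: Balaban1985BackgroundPropagators, Thm 3.4 p.400] -/
theorem sliceRadius_anti {κ a : ℝ} (hκ : 0 ≤ κ) (ha : 0 ≤ a) (d : ℕ) : sliceRadius κ a d ≤ sliceRadius κ 0 d := by
  unfold sliceRadius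
  refine min_le_min le_rfl ?_
  rw [add_zero, mul_one]
  exact div_le_div_of_nonneg_left hκ (by positivity) (by nlinarith [show (0 : ℝ) ≤ (d : ℝ) from Nat.cast_nonneg d])

variable {d : ℕ} {L : ℕ} [NeZero L] (T : BlockTree d L) (M : Fin (d + 1) → ℕ) [hM : ∀ μ, NeZero (M μ)]
variable {𝕜 : Type*} [RCLike 𝕜] {n : Type*} [Fintype n] [DecidableEq n]

/-- THE MASS FLOOR IN PART Ϩ's CURRENCY: every unitary `U₀` is `m²`-coercive for `A₀` at every `a, c ≥ 0` (PART Ϥ-k `re_quadForm_fullOpU_ge_mass`). [cite: Balaban1985BackgroundPropagators, (3.24)–(3.25) p.394] -/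
theorem mass_coercive_fullOpU {a c : ℝ} (ha : 0 ≤ a) (hc : 0 ≤ c) (m2 : ℝ) {U₀ : Tor (fine L M) × Fin (d + 1) → Matrix n n 𝕜} (hU₀ : ∀ bd, U₀ bd ∈ Matrix.unitaryGroup n 𝕜) :
    ∀ v : Tor (fine L M) × n → 𝕜, m2 * ∑ x, ‖fib (fine L M) v x‖ ^ 2 ≤ RCLike.re (star v ⬝ᵥ (fullOpU T M a c m2 U₀ *ᵥ v)) :=
  fun v => re_quadForm_fullOpU_ge_mass T M ha hc m2 hU₀ v

end Prelim

variable {d : ℕ} {L : ℕ} [NeZero L] (T : BlockTree d L) (M : Fin (d + 1) → ℕ) [hM : ∀ μ, NeZero (M μ)]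
variable {𝕜 : Type*} [RCLike 𝕜] {n : Type*} [Fintype n] [DecidableEq n]

/-! ## §2 Both operators and `Δ_eff(U,U⁻¹)` are invertible at the mass radius around every unitary background -/

section Window

variable (hD : ∀ j, T.depth j ≤ (d + 1) * (L - 1)) {a m2 : ℝ} (ha : 0 < a) (hm : 0 < m2) (hL : 1 ≤ L)
variable {U₀ : Tor (fine L M) × Fin (d + 1) → Matrix n n 𝕜} (hU₀ : ∀ bd, U₀ bd ∈ Matrix.unitaryGroup n 𝕜)
variable {U : Tor (fine L M) × Fin (d + 1) → Matrix n n 𝕜} {ε : ℝ} (hε0 : 0 ≤ ε) (hU : ∀ bd, ‖U bd - U₀ bd‖ ≤ ε) (hrad : (L : ℝ) * ε ≤ sliceRadius m2 a d)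
include hD ha hm hL hU₀ hε0 hU hrad

/-- ★ `B(U,U⁻¹) = A(U,U⁻¹)|_{a=0}` IS INVERTIBLE there too (`s₀(m²,a,d) ≤ s₀(m²,0,d)`). [cite: Balaban1985BackgroundPropagators, Thm 3.4 p.400] -/
theorem isUnit_cxFullOp_zero_at_massRadius : IsUnit (cxFullOp T M 0 ((L : ℝ) ^ 2) m2 U (fun bd => (U bd)⁻¹)) :=
  isUnit_cxFullOp_at_radius T M hD le_rfl hm.le hL hU₀ hm (mass_coercive_fullOpU T M le_rfl (by positivity) m2 hU₀) hε0 hU (hrad.trans (sliceRadius_anti hm.le ha.le d))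

/-- `‖B(U,U⁻¹)⁻¹‖ ≤ 4∕m²` — the continued fine covariance at the mass radius. [cite: Balaban1985BackgroundPropagators, Thm 3.4 p.400, (3.46) p.398 (shape)] -/
theorem l2_opNorm_cxFullOp_zero_inv_at_massRadius_le : ‖(cxFullOp T M 0 ((L : ℝ) ^ 2) m2 U (fun bd => (U bd)⁻¹))⁻¹‖ ≤ 4 / m2 :=
  l2_opNorm_cxFullOp_inv_at_radius_le T M hD le_rfl hm.le hL hU₀ hm (mass_coercive_fullOpU T M le_rfl (by positivity) m2 hU₀) hε0 hU (hrad.trans (sliceRadius_anti hm.le ha.le d))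

/-- `‖blk B(U,U⁻¹)⁻¹ x x′‖ ≤ (8∕m²)e^{−ctRate(m²∕2,0,d)·d(x,x′)∕L}` — the continued fine covariance decays at the mass radius. [cite: Balaban1985BackgroundPropagators, Thm 3.4 p.400; King1986, (4.33) p.674] -/
theorem norm_blk_cxFullOp_zero_inv_at_massRadius_le (x x' : Tor (fine L M)) :
    ‖blk (cxFullOp T M 0 ((L : ℝ) ^ 2) m2 U (fun bd => (U bd)⁻¹))⁻¹ x x'‖ ≤ 8 / m2 * Real.exp (-(ctRate (m2 / 2) 0 d / L * tdistT (fine L M) x x')) :=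
  norm_blk_cxFullOp_inv_at_radius_le T M hD le_rfl hm.le hL hU₀ hm (mass_coercive_fullOpU T M le_rfl (by positivity) m2 hU₀) hε0 hU (hrad.trans (sliceRadius_anti hm.le ha.le d)) x x'

/-- ★★★★ **KING's CONTINUED EFFECTIVE LAPLACIAN IS INVERTIBLE IN THE POLYDISC AROUND EVERY UNITARY BACKGROUND**: `Lε ≤ s₀(m²,a,d)` ⟹ `IsUnit Δ_eff(U,U⁻¹)`.
[cite: King1986, (2.14) p.653, (4.44) p.675; Balaban1985BackgroundPropagators, Thm 3.4 p.400] -/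
theorem isUnit_cxEffLap_at_massRadius : IsUnit (cxEffLap T M a ((L : ℝ) ^ 2) m2 U (fun bd => (U bd)⁻¹)) :=
  isUnit_cxEffLap_of_isUnit T M ha.ne' (isUnit_cxFullOp_at_radius T M hD ha.le hm.le hL hU₀ hm (mass_coercive_fullOpU T M ha.le (by positivity) m2 hU₀) hε0 hU hrad) (isUnit_cxFullOp_zero_at_massRadius T M hD ha hm hL hU₀ hε0 hU hrad)

/-- ★★★★ **… WITH INVERSE THE WOODBURY FORM**: `(Δ_eff(U,U⁻¹))⁻¹ = C(U,U⁻¹) = a⁻¹·1 + Q(U)B(U,U⁻¹)⁻¹Q♯_K(U⁻¹)`. [cite: King1986, (4.44) p.675; Balaban1985BackgroundPropagators, Thm 3.4 p.400] -/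
theorem inv_cxEffLap_at_massRadius : (cxEffLap T M a ((L : ℝ) ^ 2) m2 U (fun bd => (U bd)⁻¹))⁻¹ = cxBlockCov T M a ((L : ℝ) ^ 2) m2 U (fun bd => (U bd)⁻¹) :=
  inv_cxEffLap_eq_cxBlockCov T M ha.ne' (isUnit_cxFullOp_at_radius T M hD ha.le hm.le hL hU₀ hm (mass_coercive_fullOpU T M ha.le (by positivity) m2 hU₀) hε0 hU hrad) (isUnit_cxFullOp_zero_at_massRadius T M hD ha hm hL hU₀ hε0 hU hrad)

/-- `Δ_eff(U,U⁻¹)·C(U,U⁻¹) = 1` at the mass radius. [cite: King1986, (4.44) p.675] -/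
theorem cxEffLap_mul_cxBlockCov_at_massRadius : cxEffLap T M a ((L : ℝ) ^ 2) m2 U (fun bd => (U bd)⁻¹) * cxBlockCov T M a ((L : ℝ) ^ 2) m2 U (fun bd => (U bd)⁻¹) = 1 :=
  cxEffLap_mul_cxBlockCov T M ha.ne' (isUnit_cxFullOp_at_radius T M hD ha.le hm.le hL hU₀ hm (mass_coercive_fullOpU T M ha.le (by positivity) m2 hU₀) hε0 hU hrad) (isUnit_cxFullOp_zero_at_massRadius T M hD ha hm hL hU₀ hε0 hU hrad)

/-- `C(U,U⁻¹)` is invertible at the mass radius. [cite: King1986, (2.14) p.653] -/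
theorem isUnit_cxBlockCov_at_massRadius : IsUnit (cxBlockCov T M a ((L : ℝ) ^ 2) m2 U (fun bd => (U bd)⁻¹)) :=
  isUnit_cxBlockCov_of_isUnit T M ha.ne' (isUnit_cxFullOp_at_radius T M hD ha.le hm.le hL hU₀ hm (mass_coercive_fullOpU T M ha.le (by positivity) m2 hU₀) hε0 hU hrad) (isUnit_cxFullOp_zero_at_massRadius T M hD ha hm hL hU₀ hε0 hU hrad)

/-! ## §3 King's `C^{(k)}` decay ((4.32)–(4.34)) in the complex polydisc -/

/-- ★★★ **THE COVARIANCE MINUS THE NOISE DECAYS ON THE BLOCK SCALE**: `‖blk (Q(U)B(U,U⁻¹)⁻¹Q♯_K(U⁻¹)) y y′‖ ≤ (8∕m²)·e³·e^{−ctRate(m²∕2,0,d)·d_M(y,y′)}` — PART Ϩ-l's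
`norm_blk_cxSandwich_at_radius_le` AT ZERO BLOCK COUPLING with the mass floor. [cite: King1986, (4.32)–(4.34) p.674, (4.44) p.675; Dimock2013, App. D, Lemma 30; Balaban1985BackgroundPropagators, Thm 3.4 p.400] -/
theorem norm_blk_cxBlockCov_zero_sandwich_at_massRadius_le (y y' : Tor M) :
    ‖blk (covQ T M U * (cxFullOp T M 0 ((L : ℝ) ^ 2) m2 U (fun bd => (U bd)⁻¹))⁻¹ * cxKingQadj T M (fun bd => (U bd)⁻¹)) y y'‖
      ≤ 8 / m2 * Real.exp 3 * Real.exp (-(ctRate (m2 / 2) 0 d * tdistT M y y')) :=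
  norm_blk_cxSandwich_at_radius_le T M hD le_rfl hm.le hL hU₀ hm (mass_coercive_fullOpU T M le_rfl (by positivity) m2 hU₀) hε0 hU (hrad.trans (sliceRadius_anti hm.le ha.le d)) y y'

omit hM hD ha hm hL hU₀ hε0 hU hrad in
/-- The noise block: `‖a⁻¹[y = y′]·1‖ ≤ a⁻¹[y = y′]`. [folklore] -/
theorem norm_noise_blk_le (ha : 0 < a) (y y' : Tor M) : ‖(if y = y' then ((a : 𝕜))⁻¹ else 0) • (1 : Matrix n n 𝕜)‖ ≤ if y = y' then a⁻¹ else 0 := by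
  by_cases hyy : y = y'
  · rw [if_pos hyy, if_pos hyy, norm_smul, show ((a : 𝕜))⁻¹ = ((a⁻¹ : ℝ) : 𝕜) by push_cast; rfl, RCLike.norm_ofReal, abs_of_nonneg (inv_nonneg.2 ha.le)]
    calc a⁻¹ * ‖(1 : Matrix n n 𝕜)‖ ≤ a⁻¹ * 1 := mul_le_mul_of_nonneg_left (by rw [Matrix.cstar_norm_def, map_one]; exact ContinuousLinearMap.norm_id_le) (inv_nonneg.2 ha.le)
      _ = a⁻¹ := mul_one _
  · rw [if_neg hyy, if_neg hyy, zero_smul, norm_zero]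

/-- ★★★★ **KING's `C^{(k)}` DECAY ((4.32)–(4.34)) IN THE COMPLEX POLYDISC AROUND EVERY UNITARY BACKGROUND**: `‖blk C(U,U⁻¹) y y′‖ ≤ a⁻¹[y = y′] + (8∕m²)e³·e^{−ctRate(m²∕2,0,d)·d_M(y,y′)}` — NE2's unit-layer
covariance decays exponentially on the block lattice, with constants depending on `(m², a, d)` only, at every complex `U` of the polydisc and every unitary centre (any curvature).
[cite: King1986, (4.32)–(4.34) p.674, (4.44) p.675; Balaban1985BackgroundPropagators, Thm 3.4 p.400] -/
theorem norm_blk_cxBlockCov_at_massRadius_le (y y' : Tor M) :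
    ‖blk (cxBlockCov T M a ((L : ℝ) ^ 2) m2 U (fun bd => (U bd)⁻¹)) y y'‖ ≤ (if y = y' then a⁻¹ else 0) + 8 / m2 * Real.exp 3 * Real.exp (-(ctRate (m2 / 2) 0 d * tdistT M y y')) := by
  rw [blk_cxBlockCov]
  exact (norm_add_le _ _).trans (add_le_add (norm_noise_blk_le M ha y y') (norm_blk_cxBlockCov_zero_sandwich_at_massRadius_le T M hD ha hm hL hU₀ hε0 hU hrad y y'))

/-- ★★★ **THE UNIFORM SHAPE**: `‖blk C(U,U⁻¹) y y′‖ ≤ (a⁻¹ + (8∕m²)e³)·e^{−ctRate(m²∕2,0,d)·d_M(y,y′)}` — the tree's `effLaplacian_inv_decay` shape `C·e^{−κ·d(b,b′)}` in the polydisc.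
[cite: King1986, (4.32)–(4.34) p.674; Balaban1985BackgroundPropagators, Thm 3.4 p.400] -/
theorem norm_blk_cxBlockCov_at_massRadius_le' (y y' : Tor M) :
    ‖blk (cxBlockCov T M a ((L : ℝ) ^ 2) m2 U (fun bd => (U bd)⁻¹)) y y'‖ ≤ (a⁻¹ + 8 / m2 * Real.exp 3) * Real.exp (-(ctRate (m2 / 2) 0 d * tdistT M y y')) := by
  refine (norm_blk_cxBlockCov_at_massRadius_le T M hD ha hm hL hU₀ hε0 hU hrad y y').trans ?_
  have h1 : (if y = y' then a⁻¹ else 0) ≤ a⁻¹ * Real.exp (-(ctRate (m2 / 2) 0 d * tdistT M y y')) := by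
    by_cases hyy : y = y'
    · subst hyy; rw [if_pos rfl, tdistT_self, mul_zero, neg_zero, Real.exp_zero, mul_one]
    · rw [if_neg hyy]; exact mul_nonneg (inv_nonneg.2 ha.le) (Real.exp_nonneg _)
  calc (if y = y' then a⁻¹ else 0) + 8 / m2 * Real.exp 3 * Real.exp (-(ctRate (m2 / 2) 0 d * tdistT M y y'))
      ≤ a⁻¹ * Real.exp (-(ctRate (m2 / 2) 0 d * tdistT M y y')) + 8 / m2 * Real.exp 3 * Real.exp (-(ctRate (m2 / 2) 0 d * tdistT M y y')) := add_le_add_left h1 _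
    _ = _ := by ring

/-- OFF THE DIAGONAL ONLY THE SANDWICH: `y ≠ y′` ⟹ `‖blk C(U,U⁻¹) y y′‖ ≤ (8∕m²)e³e^{−ctRate(m²∕2,0,d)d_M(y,y′)}`. [cite: King1986, (4.32)–(4.34) p.674] -/
theorem norm_blk_cxBlockCov_offDiag_at_massRadius_le {y y' : Tor M} (hyy : y ≠ y') :
    ‖blk (cxBlockCov T M a ((L : ℝ) ^ 2) m2 U (fun bd => (U bd)⁻¹)) y y'‖ ≤ 8 / m2 * Real.exp 3 * Real.exp (-(ctRate (m2 / 2) 0 d * tdistT M y y')) := by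
  rw [blk_cxBlockCov_of_ne T M _ _ _ _ _ hyy]
  exact norm_blk_cxBlockCov_zero_sandwich_at_massRadius_le T M hD ha hm hL hU₀ hε0 hU hrad y y'

/-- ★★★ **THE WINDOW PACKAGE AT EVERY UNITARY BACKGROUND**: `A(U,U⁻¹)`, `B(U,U⁻¹)`, `Δ_eff(U,U⁻¹)` invertible ∧ `(Δ_eff(U,U⁻¹))⁻¹ = C(U,U⁻¹)` ∧ `‖B⁻¹‖ ≤ 4∕m²` ∧ King's `C^{(k)}` decay ((4.32)–(4.34)) for `C` on every pair of blocks.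
[cite: King1986, (4.32)–(4.34) p.674, (4.44) p.675; Balaban1985BackgroundPropagators, Thm 3.4 p.400] -/
theorem king_blockCov_window :
    IsUnit (cxFullOp T M a ((L : ℝ) ^ 2) m2 U (fun bd => (U bd)⁻¹)) ∧ IsUnit (cxFullOp T M 0 ((L : ℝ) ^ 2) m2 U (fun bd => (U bd)⁻¹))
      ∧ IsUnit (cxEffLap T M a ((L : ℝ) ^ 2) m2 U (fun bd => (U bd)⁻¹))
      ∧ (cxEffLap T M a ((L : ℝ) ^ 2) m2 U (fun bd => (U bd)⁻¹))⁻¹ = cxBlockCov T M a ((L : ℝ) ^ 2) m2 U (fun bd => (U bd)⁻¹)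
      ∧ ‖(cxFullOp T M 0 ((L : ℝ) ^ 2) m2 U (fun bd => (U bd)⁻¹))⁻¹‖ ≤ 4 / m2
      ∧ ∀ y y' : Tor M, ‖blk (cxBlockCov T M a ((L : ℝ) ^ 2) m2 U (fun bd => (U bd)⁻¹)) y y'‖ ≤ (if y = y' then a⁻¹ else 0) + 8 / m2 * Real.exp 3 * Real.exp (-(ctRate (m2 / 2) 0 d * tdistT M y y')) :=
  ⟨isUnit_cxFullOp_at_radius T M hD ha.le hm.le hL hU₀ hm (mass_coercive_fullOpU T M ha.le (by positivity) m2 hU₀) hε0 hU hrad, isUnit_cxFullOp_zero_at_massRadius T M hD ha hm hL hU₀ hε0 hU hrad,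
    isUnit_cxEffLap_at_massRadius T M hD ha hm hL hU₀ hε0 hU hrad, inv_cxEffLap_at_massRadius T M hD ha hm hL hU₀ hε0 hU hrad,
    l2_opNorm_cxFullOp_zero_inv_at_massRadius_le T M hD ha hm hL hU₀ hε0 hU hrad, norm_blk_cxBlockCov_at_massRadius_le T M hD ha hm hL hU₀ hε0 hU hrad⟩

end Window

/-! ## §4 At a unitary field: King's `C^{(k)}` decay ((4.32)–(4.34)) at every curved background, no window -/

section Unitary

variable (hD : ∀ j, T.depth j ≤ (d + 1) * (L - 1)) {a m2 : ℝ} (ha : 0 < a) (hm : 0 < m2) (hL : 1 ≤ L)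
variable {U : Tor (fine L M) × Fin (d + 1) → Matrix n n 𝕜} (hU : ∀ bd, U bd ∈ Matrix.unitaryGroup n 𝕜)
include hD ha hm hL hU

/-- ★★★ **KING's `C^{(k)}` DECAY ((4.32)–(4.34)) AT EVERY UNITARY BACKGROUND** (any curvature, no window): `‖blk (Δ_eff(U))⁻¹ y y′‖ ≤ a⁻¹[y = y′] + (8∕m²)e³·e^{−ctRate(m²∕2,0,d)·d_M(y,y′)}` — NE2's unit-layer
covariance `C^{(K)}(U) = (Δ_eff(U))⁻¹` decays exponentially on the block lattice with constants `(m²,a,d)` only (second proof; PART Ϥ-l's Kato domination gives King's `A = 0` constants).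
[cite: King1986, (4.32)–(4.34) p.674, (4.44) p.675; Balaban1985BackgroundPropagators, (3.25) p.394] -/
theorem norm_blk_effLapU_inv_le (y y' : Tor M) :
    ‖blk ((effLapU T M a ((L : ℝ) ^ 2) m2 U)⁻¹) y y'‖ ≤ (if y = y' then a⁻¹ else 0) + 8 / m2 * Real.exp 3 * Real.exp (-(ctRate (m2 / 2) 0 d * tdistT M y y')) := by
  rw [← cxBlockCov_inv_of_unitary T M ha (by positivity) hm hU]
  have h0 : ∀ bd, ‖U bd - U bd‖ ≤ 0 := fun bd => by rw [sub_self, norm_zero]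
  exact norm_blk_cxBlockCov_at_massRadius_le T M hD ha hm hL hU le_rfl h0 (by rw [mul_zero]; exact (sliceRadius_pos hm ha.le d).le) y y'

/-- ★★★ uniform shape at every unitary background: `‖blk (Δ_eff(U))⁻¹ y y′‖ ≤ (a⁻¹ + (8∕m²)e³)e^{−ctRate(m²∕2,0,d)d_M(y,y′)}`. [cite: King1986, (4.32)–(4.34) p.674] -/
theorem norm_blk_effLapU_inv_le' (y y' : Tor M) :
    ‖blk ((effLapU T M a ((L : ℝ) ^ 2) m2 U)⁻¹) y y'‖ ≤ (a⁻¹ + 8 / m2 * Real.exp 3) * Real.exp (-(ctRate (m2 / 2) 0 d * tdistT M y y')) := by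
  rw [← cxBlockCov_inv_of_unitary T M ha (by positivity) hm hU]
  have h0 : ∀ bd, ‖U bd - U bd‖ ≤ 0 := fun bd => by rw [sub_self, norm_zero]
  exact norm_blk_cxBlockCov_at_massRadius_le' T M hD ha hm hL hU le_rfl h0 (by rw [mul_zero]; exact (sliceRadius_pos hm ha.le d).le) y y'

end Unitary

end Summit.QuantumFields.YangMills.BalabanUVNodes.N15KingModelRung.Analytic

end
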